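import Mathlib
import Summits.NavierStokesRegularity.NavierStokesRegularity.Theorems.EulerZoomLiouvillePowerGaugeEulerLiouvilleSelfSimilarTopBadNodeArcTools
import Summits.NavierStokesRegularity.NavierStokesRegularity.Theorems.EulerZoomLiouvillePowerGaugeEulerLiouvilleSelfSimilarTopBadNodeArcBernoulli
import Summits.NavierStokesRegularity.NavierStokesRegularity.Theorems.EulerZoomLiouvillePowerGaugeEulerLiouvilleSelfSimilarTopBadNodeArcDynamics
import Summits.NavierStokesRegularity.NavierStokesRegularity.Theorems.EulerZoomLiouvillePowerGaugeEulerLiouvilleSelfSimilarTopBadNodeArcSpectral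
import HarnessLib.Audit

/-!
# Rung C1 of the crux `EulerZoomLiouville.PowerGaugeEulerLiouville`: the top bad node is NOT an interior
# point of a stagnation arc

Route №10 `EulerZoomLiouville` (NavierStokesRegularity), crux E = stmt-NavierStokesRegularity-19832,
tenure rung C1 (exactly self-similar members), registered residue `stub_selfSimilarExtremal`.
Eleventh file of the NODAL-CONTINUUM line (lineage ns-typeII-p1, gen 7).  Setting: `0 < γ < ½`, a `C²`
stationary self-similar Euler profile `(U, P)` (CIV 2026 (3.3)) with the far field (3.8); `V = γ(y−c)+U`,
`Ω = curl U`, `ℋ` (3.30), `O = {Ω ≠ 0}`.  After `eq_zero_of_badNodes_nondegenerate` /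
`exists_degenerate_topBadNode_of_ne_zero` the classical survivor carries a DEGENERATE top bad node `z♭`
(`Ω(z♭) = 0`, a unit stretching rate `≥ 1`, `DV(z♭)e = 0` for a unit `e`, `z♭ ∈ ∂O`, `O ⊆ {ℋ < ℋ(z♭)}`):
the configuration of a stagnation CURVE through `z♭` tangent to `e`.  This file kills that
configuration:

`false_of_topBadNode_of_arc` — **if through such a node passes a `C^{1,1}` arc of stagnation points
`τ ↦ z♭ + τe + g(τ)` (`g ⊥ e`, `g(0) = 0`, `|g'(τ)| ≤ L|τ|` for `|τ| ≤ δ`), contradiction.**  Mechanism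
(exit analysis in tube coordinates, no invariant-manifold theory): write a backward
  trajectory near `z♭` as `Y = Γ(τ) + ξ` with `τ = ⟪e, Y − z♭⟫`, `Γ(τ)` on the arc and `ξ ⊥ e`; since
  `V(Γ(τ)) = 0`, the two-point linearisation gives `ξ' = −Aξ + O(ρ|ξ|)`, `τ' = O(ρ|ξ|)` with `A = DV(z♭)`
  symmetric, `ker A = ℝe` (`kernel_coord_eq_zero_of_top`), eigenvalues `≥ μ` / `≤ −μ` off the kernel.
  In eigen-coordinates (`p` = contracting part, `m` = expanding part of `|ξ|²`): the cone `{m ≥ Kp}` is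
  forward-invariant and a trajectory in it reaches the exit sphere `|Y − z♭| = r` with
  `ℋ(Y) ≥ ℋ(Γ(τ)) + (1−2γ)μ|ξ|²/16 > ℋ(z♭)` (uniform Bernoulli expansion at the nodes of the arc, `ℋ`
  constant along the arc) — impossible on `O`; a trajectory never in the cone has `p` decaying
  exponentially, hence `|ξ|` and the drift of `τ` are `O(ε)`, so it never reaches the exit sphere.  So
  EVERY vortical point `ε`-close to `z♭` is backward-trapped in `B̄(z♭, r)` — an open set inside the
  trapped set, contradicting the cone lemma at the bad node (`exists_thinRadius_of_badNode`).
Sequel `…SelfSimilarTopBadNodeArcPortrait`: the survivor portrait (the top bad node is a SINGULAR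
point of the nodal set — no stagnation arc, in particular no stagnation ring, passes through it).

WHAT THIS IS NOT: not NS, not E, not rung C1 — `C²` profiles with (3.8); arcs are `C^{1,1}` graphs over
the kernel line; endpoints / non-arc nodal structure at `z♭` untouched.  References: CIV, arXiv:2602.17570
(2026), §3.4.3–§3.5, §4 [ConstantinIgnatovaVicol2026Putative]; Katok–Hasselblatt (1995) §6.2 [KatokHasselblatt1995].
-/

noncomputable section

-- flat `Theorems/<Route><Decl>…` files of one crux share the namespace of the crux (tree convention)
set_option linter.dupNamespace false

open Set Filter Topology Metric Function InnerProductSpace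
open scoped RealInnerProductSpace NNReal

namespace Summit.NavierStokesRegularity.NavierStokesRegularity.Theorems.PowerGaugeEulerLiouville.NodalContinuum

open Literature.Analysis Literature.Analysis.FluidPDE Literature.Analysis.ODE
open Summit.NavierStokesRegularity.NavierStokesRegularity.Theorems.PowerGaugeEulerLiouville.NodalFiniteness

variable {γ C : ℝ} {c : EuclideanSpace ℝ (Fin 3)}
  {U : EuclideanSpace ℝ (Fin 3) → EuclideanSpace ℝ (Fin 3)} {P : EuclideanSpace ℝ (Fin 3) → ℝ}

set_option maxHeartbeats 800000 in
/-- **Core: the top bad node is not an interior point of a stagnation arc.**  `0 < γ < ½`, `(U, P)` a `C²`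
profile with (3.8), `z` a stagnation point with `curl U(z) = 0`, a unit `w` with `⟪DU(z)w, w⟫ ≥ 1`,
adherent to `O = {curl U ≠ 0}`, `ℋ < ℋ(z)` on `O`; `e` a unit vector with `DV(z)e = 0`; `τ ↦ z + τe + g(τ)`
(`|τ| ≤ δ`) an arc of STAGNATION POINTS with `g ⊥ e`, `g(0) = 0`, `|g'(τ)| ≤ L|τ|`.  Then `False`
(tube-coordinate exit analysis, see the module docstring).
[cite: ConstantinIgnatovaVicol2026Putative, §3.4.3–§3.5, §4 (local analysis not in print)] [cite: KatokHasselblatt1995, §6.2 (cone criterion)] -/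
theorem false_of_topBadNode_of_arc (h : IsSelfSimilarEulerProfile γ c U P) (hγ : 0 < γ)
    (hγ2 : γ < 1 / 2) (hfar : HasSelfSimilarFarFieldWith γ c C U) {z : EuclideanSpace ℝ (Fin 3)}
    (hz : z ∈ selfSimilarNodalSet γ c U) (hΩz : curl U z = 0)
    (hbad : ∃ w : EuclideanSpace ℝ (Fin 3), ‖w‖ = 1 ∧ 1 ≤ ⟪fderiv ℝ U z w, w⟫)
    (hcl : z ∈ closure {y | curl U y ≠ 0})
    (hconf : ∀ x, curl U x ≠ 0 → selfSimilarBernoulli γ c U P x < selfSimilarBernoulli γ c U P z)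
    {e : EuclideanSpace ℝ (Fin 3)} (he1 : ‖e‖ = 1)
    (hAe : fderiv ℝ (selfSimilarTransport γ c U) z e = 0)
    {g g' : ℝ → EuclideanSpace ℝ (Fin 3)} {δ L : ℝ} (hδ : 0 < δ) (hL : 0 ≤ L) (hg0 : g 0 = 0)
    (hge : ∀ τ, ⟪e, g τ⟫ = 0) (hgd : ∀ τ, HasDerivAt g (g' τ) τ)
    (hg' : ∀ τ, |τ| ≤ δ → ‖g' τ‖ ≤ L * |τ|)
    (harc : ∀ τ, |τ| ≤ δ → z + τ • e + g τ ∈ selfSimilarNodalSet γ c U) : False := by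
  classical
  set V := selfSimilarTransport γ c U with hV
  set A : EuclideanSpace ℝ (Fin 3) →L[ℝ] EuclideanSpace ℝ (Fin 3) := fderiv ℝ V z with hAdef
  set Hb := selfSimilarBernoulli γ c U P with hHb
  have hγ' : γ ≠ 1 / 2 := hγ2.ne
  have hK := lipschitzWith_transport h hγ hfar
  have hUd := h.differentiable_velocity
  have hVz : V z = 0 := hz
  have hA : (A : EuclideanSpace ℝ (Fin 3) →ₗ[ℝ] EuclideanSpace ℝ (Fin 3)).IsSymmetric :=
    isSymmetric_fderiv_transport_of_curl_eq_zero h hΩz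
  have hAe' : A e = 0 := hAe
  /- ── eigen-data, the kernel line, spectral constants ── -/
  obtain ⟨b, a, μ, α, hb, hμpos, hμα, hαge, hpos_i, hneg_i⟩ :=
    exists_spectralData_of_badNode h hγ hγ2 hΩz hbad he1 hAe
  have hαpos : 0 < α := lt_of_lt_of_le hμpos hμα
  /- ── the THIN radius and the constants ── -/
  obtain ⟨δ₀, hδ₀, hthin⟩ := exists_thinRadius_of_badNode h hγ2 hK hΩz hbad
  set K : ℝ := 2 * α / μ + 1 with hKdef
  have hK1 : 1 ≤ K := by
    have : 0 ≤ 2 * α / μ := by positivity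
    rw [hKdef]; linarith only [this]
  have hKpos : 0 < K := by linarith
  have hKα : α ≤ K * μ / 2 := by
    rw [hKdef]
    have : (2 * α / μ + 1) * μ / 2 = α + μ / 2 := by field_simp
    rw [this]; linarith only [hμpos]
  have h12 : 0 < 1 - 2 * γ := by linarith
  set ν : ℝ := (1 - 2 * γ) * μ / 16 with hν
  have hνpos : 0 < ν := by positivity
  obtain ⟨δ₁, hδ₁, hexp⟩ := selfSimilarBernoulli_expansion_near_of_curl_eq_zero h hΩz hνpos
  set ρ : ℝ := μ / (12 * (1 + K)) with hρ
  have hρpos : 0 < ρ := by positivity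
  obtain ⟨δ₂, hδ₂, hlin⟩ := exists_ball_linearisation h z hρpos
  set r : ℝ := min (min δ₀ δ₁) (min δ₂ (min δ (1 / (L + 1)))) / 4 with hr
  have hmpos : 0 < min (min δ₀ δ₁) (min δ₂ (min δ (1 / (L + 1)))) :=
    lt_min (lt_min hδ₀ hδ₁) (lt_min hδ₂ (lt_min hδ (by positivity)))
  have hrpos : 0 < r := by positivity
  have hr4 : 4 * r = min (min δ₀ δ₁) (min δ₂ (min δ (1 / (L + 1)))) := by rw [hr]; ring
  have hrδ₀ : 4 * r ≤ δ₀ := by rw [hr4]; exact (min_le_left _ _).trans (min_le_left _ _)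
  have hrδ₁ : 4 * r ≤ δ₁ := by rw [hr4]; exact (min_le_left _ _).trans (min_le_right _ _)
  have hrδ₂ : 4 * r ≤ δ₂ := by rw [hr4]; exact (min_le_right _ _).trans (min_le_left _ _)
  have hrδ : 4 * r ≤ δ := by
    rw [hr4]; exact (min_le_right _ _).trans ((min_le_right _ _).trans (min_le_left _ _))
  have hrL : 4 * r ≤ 1 / (L + 1) := by
    rw [hr4]; exact (min_le_right _ _).trans ((min_le_right _ _).trans (min_le_right _ _))
  have hLr : L * r ≤ 1 / 4 := by
    have h1 : L * (4 * r) ≤ L * (1 / (L + 1)) := mul_le_mul_of_nonneg_left hrL hL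
    have h2 : L * (1 / (L + 1)) ≤ 1 := by
      rw [mul_one_div, div_le_one (by linarith only [hL])]; linarith only [hL]
    linarith only [h1, h2]
  set ε : ℝ := r / (8 * (1 + K)) with hε
  have hεpos : 0 < ε := by positivity
  have hεK : 8 * (1 + K) * ε = r := by rw [hε]; field_simp
  have hεr : ε ≤ r / 8 := by
    rw [hε, div_le_div_iff₀ (by positivity) (by norm_num)]; nlinarith only [hrpos.le, hK1]
  /- ── every vortical point `ε`-close to `z` is backward-trapped in `B̄(z, r)` ── -/
  have htrap : ∀ x, curl U x ≠ 0 → dist x z < ε →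
      ∀ t, 0 ≤ t → lipschitzFlow hK x (-t) ∈ closedBall z r := by
    intro x hxO hxε
    by_contra hnot
    push Not at hnot
    obtain ⟨t₀, ht₀, hout⟩ := hnot
    rw [mem_closedBall, dist_eq_norm, not_le] at hout
    -- the trajectory and its first exit time
    set Y : ℝ → EuclideanSpace ℝ (Fin 3) := fun t => lipschitzFlow hK x (-t) with hYdef
    have hY : ∀ t, HasDerivAt Y ((-1 : ℝ) • V (Y t)) t := hasDerivAt_backwardFlow hK x
    have hY0 : Y 0 = x := by simp [hYdef]
    have hYc : Continuous Y := continuous_iff_continuousAt.2 fun t => (hY t).continuousAt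
    obtain ⟨Bd, hBd⟩ := backward_orbit_bounded hγ hfar hY
    have h0r : ‖Y 0 - z‖ < r := by rw [hY0, ← dist_eq_norm]; linarith only [hxε, hεr, hrpos]
    obtain ⟨t₁, ht₁pos, -, hexit, hin, -⟩ := exists_firstExit hYc h0r ht₀ hout
    have hYO : ∀ t, 0 ≤ t → curl U (Y t) ≠ 0 := by
      intro t ht h0
      have := curl_comp_eq_zero_of_curl_comp_eq_zero h hY hBd ht h0
      rw [hY0] at this
      exact hxO this
    set ζ : ℝ → EuclideanSpace ℝ (Fin 3) := fun t => Y t - z with hζdef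
    set τ : ℝ → ℝ := fun t => ⟪e, ζ t⟫ with hτdef
    set Γ : ℝ → EuclideanSpace ℝ (Fin 3) := fun t => z + τ t • e + g (τ t) with hΓdef
    set ξ : ℝ → EuclideanSpace ℝ (Fin 3) := fun t => ζ t - τ t • e - g (τ t) with hξdef
    have hYΓξ : ∀ t, Y t = Γ t + ξ t := by intro t; simp only [hΓdef, hξdef, hζdef]; abel
    have hee : ⟪e, e⟫ = 1 := by rw [real_inner_self_eq_norm_sq, he1]; norm_num
    have hξe : ∀ t, ⟪e, ξ t⟫ = 0 := by
      intro t; simp only [hξdef, hτdef, inner_sub_right, inner_smul_right, hee, hge]; ring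
    have hτle : ∀ t ∈ Icc 0 t₁, |τ t| ≤ r := fun t ht =>
      ((abs_real_inner_le_norm e (ζ t)).trans (by rw [he1, one_mul])).trans (hin t ht)
    have hτδ : ∀ t ∈ Icc 0 t₁, |τ t| ≤ δ := fun t ht =>
      (hτle t ht).trans (by linarith only [hrδ, hrpos])
    have hΓN : ∀ t ∈ Icc 0 t₁, Γ t ∈ selfSimilarNodalSet γ c U := fun t ht => harc _ (hτδ t ht)
    have hgτ : ∀ t ∈ Icc 0 t₁, ‖g (τ t)‖ ≤ L * τ t ^ 2 := fun t ht =>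
      norm_graph_le_sq hL hg0 hgd hg' (hτδ t ht)
    have hgτ' : ∀ t ∈ Icc 0 t₁, ‖g (τ t)‖ ≤ |τ t| / 4 := by
      intro t ht
      have h1 := hgτ t ht
      have h2 : L * τ t ^ 2 = (L * |τ t|) * |τ t| := by rw [mul_assoc, ← sq_abs]; ring
      have h3 : L * |τ t| ≤ 1 / 4 := (mul_le_mul_of_nonneg_left (hτle t ht) hL).trans hLr
      rw [h2] at h1
      exact h1.trans ((mul_le_mul_of_nonneg_right h3 (abs_nonneg _)).trans_eq (by ring))
    have hΓz : ∀ t ∈ Icc 0 t₁, ‖Γ t - z‖ ≤ 2 * r := by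
      intro t ht
      have e1 : Γ t - z = τ t • e + g (τ t) := by simp only [hΓdef]; abel
      rw [e1]
      calc ‖τ t • e + g (τ t)‖ ≤ ‖τ t • e‖ + ‖g (τ t)‖ := norm_add_le _ _
        _ ≤ |τ t| + |τ t| / 4 := by
            rw [norm_smul, Real.norm_eq_abs, he1, mul_one]; exact add_le_add le_rfl (hgτ' t ht)
        _ ≤ 2 * r := by linarith only [hτle t ht, hrpos]
    have hξle : ∀ t ∈ Icc 0 t₁, ‖ξ t‖ ≤ 3 * r := by
      intro t ht
      have e1 : ξ t = (Y t - z) - (Γ t - z) := by rw [hYΓξ t]; abel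
      rw [e1]
      exact (norm_sub_le _ _).trans (by linarith only [hin t ht, hΓz t ht])
    have hHΓ : ∀ t ∈ Icc 0 t₁, Hb (Γ t) = Hb z := by
      intro t ht
      have hΓd : ∀ s : ℝ, HasDerivAt (fun s : ℝ => z + s • e + g s) (e + g' s) s := by
        intro s
        have h1 : HasDerivAt (fun s : ℝ => z + s • e) e s := by
          simpa using ((hasDerivAt_id s).smul_const e).const_add z
        exact h1.add (hgd s)
      have := selfSimilarBernoulli_const_on_arc h hγ' hΓd harc (hτδ t ht)
      simp only [zero_smul, add_zero, hg0] at this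
      exact this
    have hξne : ∀ t ∈ Icc 0 t₁, ξ t ≠ 0 := by
      intro t ht h0
      have e1 : Y t = Γ t := by rw [hYΓξ t, h0, add_zero]
      have h1 := hconf (Y t) (hYO t ht.1)
      rw [e1, hHΓ t ht] at h1
      exact lt_irrefl _ h1
    have hE : ∀ t ∈ Icc 0 t₁, ‖V (Y t) - A (ξ t)‖ ≤ ρ * ‖ξ t‖ := by
      intro t ht
      have hm1 : Y t ∈ closedBall z δ₂ := by
        rw [mem_closedBall, dist_eq_norm]; linarith only [hin t ht, hrδ₂, hrpos]
      have hm2 : Γ t ∈ closedBall z δ₂ := by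
        rw [mem_closedBall, dist_eq_norm]; linarith only [hΓz t ht, hrδ₂, hrpos]
      have := hlin (Y t) hm1 (Γ t) hm2
      have hVΓ : V (Γ t) = 0 := hΓN t ht
      rw [← hV, ← hAdef, hVΓ, sub_zero, show Y t - Γ t = ξ t by rw [hYΓξ t]; abel] at this
      exact this
    have hζ' : ∀ t, HasDerivAt ζ ((-1 : ℝ) • V (Y t)) t := fun t => (hY t).sub_const z
    set τd : ℝ → ℝ := fun t => ⟪e, (-1 : ℝ) • V (Y t)⟫ with hτd
    have hτ' : ∀ t, HasDerivAt τ (τd t) t := by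
      intro t
      have := (hasDerivAt_const t e).inner ℝ (hζ' t)
      simpa [hτd] using this
    set F : ℝ → EuclideanSpace ℝ (Fin 3) :=
      fun t => (V (Y t) - A (ξ t)) + τd t • e + τd t • g' (τ t) with hFdef
    have hξ' : ∀ t, HasDerivAt ξ (-(A (ξ t)) - F t) t := by
      intro t
      have hgτd : HasDerivAt (fun s => g (τ s)) (τd t • g' (τ t)) t := (hgd (τ t)).scomp t (hτ' t)
      have h1 := ((hζ' t).sub ((hτ' t).smul_const e)).sub hgτd
      refine h1.congr_deriv ?_
      simp only [hFdef, neg_one_smul]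
      abel
    have hτdE : ∀ t, τd t = -⟪e, V (Y t) - A (ξ t)⟫ := by
      intro t
      have hsym : ⟪e, A (ξ t)⟫ = 0 := by
        have := hA e (ξ t)
        simp only [ContinuousLinearMap.coe_coe] at this
        rw [← this, hAe', inner_zero_left]
      simp only [hτd, inner_smul_right, inner_sub_right, hsym]; ring
    have hτdle : ∀ t ∈ Icc 0 t₁, |τd t| ≤ ρ * ‖ξ t‖ := by
      intro t ht
      rw [hτdE t, abs_neg]
      exact ((abs_real_inner_le_norm _ _).trans (by rw [he1, one_mul])).trans (hE t ht)
    have hFle : ∀ t ∈ Icc 0 t₁, ‖F t‖ ≤ 3 * ρ * ‖ξ t‖ := by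
      intro t ht
      have h1 := hE t ht
      have h2 : ‖τd t • e‖ ≤ ρ * ‖ξ t‖ := by
        rw [norm_smul, Real.norm_eq_abs, he1, mul_one]; exact hτdle t ht
      have h3 : ‖τd t • g' (τ t)‖ ≤ ρ * ‖ξ t‖ := by
        rw [norm_smul, Real.norm_eq_abs]
        have hg1 : ‖g' (τ t)‖ ≤ 1 := by
          have := hg' (τ t) (hτδ t ht)
          have h4 : L * |τ t| ≤ 1 / 4 := (mul_le_mul_of_nonneg_left (hτle t ht) hL).trans hLr
          linarith only [this, h4]
        calc |τd t| * ‖g' (τ t)‖ ≤ ρ * ‖ξ t‖ * 1 :=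
              mul_le_mul (hτdle t ht) hg1 (norm_nonneg _) (by positivity)
          _ = ρ * ‖ξ t‖ := mul_one _
      calc ‖F t‖ ≤ ‖(V (Y t) - A (ξ t)) + τd t • e‖ + ‖τd t • g' (τ t)‖ := norm_add_le _ _
        _ ≤ (‖V (Y t) - A (ξ t)‖ + ‖τd t • e‖) + ‖τd t • g' (τ t)‖ :=
            add_le_add (norm_add_le _ _) le_rfl
        _ ≤ 3 * ρ * ‖ξ t‖ := by linarith only [h1, h2, h3]
    set Ip : Finset (Fin 3) := Finset.univ.filter (fun i => 0 < a i) with hIp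
    set In : Finset (Fin 3) := Finset.univ.filter (fun i => ¬ 0 < a i) with hIn
    set p : ℝ → ℝ := fun t => ∑ i ∈ Ip, ⟪b i, ξ t⟫ ^ 2 with hpdef
    set m : ℝ → ℝ := fun t => ∑ i ∈ In, ⟪b i, ξ t⟫ ^ 2 with hmdef
    set pd : ℝ → ℝ := fun t => ∑ i ∈ Ip, 2 * ⟪b i, ξ t⟫ * ⟪b i, -(A (ξ t)) - F t⟫ with hpd
    set md : ℝ → ℝ := fun t => ∑ i ∈ In, 2 * ⟪b i, ξ t⟫ * ⟪b i, -(A (ξ t)) - F t⟫ with hmd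
    have hcoord : ∀ i t, HasDerivAt (fun s => ⟪b i, ξ s⟫) ⟪b i, -(A (ξ t)) - F t⟫ t := by
      intro i t
      have := (hasDerivAt_const t (b i)).inner ℝ (hξ' t)
      simpa using this
    have hp' : ∀ t, HasDerivAt p (pd t) t := by
      intro t
      simp only [hpdef, hpd]
      refine HasDerivAt.fun_sum fun i _ => ?_
      have := (hcoord i t).mul (hcoord i t)
      simp only [← sq] at this
      exact this.congr_deriv (by ring)
    have hm' : ∀ t, HasDerivAt m (md t) t := by
      intro t
      simp only [hmdef, hmd]
      refine HasDerivAt.fun_sum fun i _ => ?_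
      have := (hcoord i t).mul (hcoord i t)
      simp only [← sq] at this
      exact this.congr_deriv (by ring)
    have hpm : ∀ t, p t + m t = ‖ξ t‖ ^ 2 := fun t => sum_sq_inner_filter_add b _ (ξ t)
    have hpnn : ∀ t, 0 ≤ p t := fun t => Finset.sum_nonneg fun i _ => sq_nonneg _
    have hmnn : ∀ t, 0 ≤ m t := fun t => Finset.sum_nonneg fun i _ => sq_nonneg _
    have hIp' : ∀ i ∈ Ip, μ ≤ a i := fun i hi => hpos_i i (Finset.mem_filter.1 hi).2
    have hIn' : ∀ t, ∀ i ∈ In, a i ≤ -μ ∨ ⟪b i, ξ t⟫ = 0 :=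
      fun t i hi => hneg_i (ξ t) (hξe t) i (Finset.mem_filter.1 hi).2
    -- the differential inequalities on `[0, t₁]`, with `c = 9ρ²/μ`
    set cst : ℝ := 9 * ρ ^ 2 / μ with hcst
    have hcst0 : 0 ≤ cst := by positivity
    have hcK : cst * (1 + K) = μ / (16 * (1 + K)) := by rw [hcst, hρ]; field_simp; ring
    have hcK16 : cst * (1 + K) ≤ μ / 16 := by
      rw [hcK, div_le_div_iff₀ (by positivity) (by norm_num)]; nlinarith only [hμpos.le, hK1]
    have hcK2 : cst * (1 + K) ≤ μ / 2 := hcK16.trans (by linarith only [hμpos])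
    have hF2 : ∀ t ∈ Icc 0 t₁, ‖F t‖ ^ 2 / μ ≤ cst * (p t + m t) := by
      intro t ht
      have := pow_le_pow_left₀ (norm_nonneg _) (hFle t ht) 2
      rw [hpm t, hcst]
      calc ‖F t‖ ^ 2 / μ ≤ (3 * ρ * ‖ξ t‖) ^ 2 / μ := div_le_div_of_nonneg_right this hμpos.le
        _ = 9 * ρ ^ 2 / μ * ‖ξ t‖ ^ 2 := by ring
    have hpd_le : ∀ t ∈ Icc 0 t₁, pd t ≤ -μ * p t + cst * (p t + m t) := by
      intro t ht
      have h1 := sum_coord_velocity_le hA b hb hμpos Ip hIp' (ξ t) (F t)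
      have h2 := hF2 t ht
      show pd t ≤ _
      simp only [hpd, hpdef]
      linarith only [h1, h2]
    have hmd_ge : ∀ t ∈ Icc 0 t₁, μ * m t - cst * (p t + m t) ≤ md t := by
      intro t ht
      have h1 := sum_coord_velocity_ge hA b hb hμpos In (ξ t) (F t) (hIn' t)
      have h2 := hF2 t ht
      show _ ≤ md t
      simp only [hmd, hmdef]
      linarith only [h1, h2]
    have hposm : ∀ t ∈ Icc 0 t₁, 0 < p t + m t := by
      intro t ht
      rw [hpm t]
      exact pow_pos (norm_pos_iff.2 (hξne t ht)) 2
    have hHlt : Hb (Y t₁) < Hb z := hconf _ (hYO t₁ ht₁pos.le)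
    by_cases hc : ∃ t ∈ Icc 0 t₁, K * p t ≤ m t
    · /- Case A: the trajectory enters the cone `{m ≥ K p}`; the cone is invariant up to `t₁` -/
      obtain ⟨tc, htc, hcone0⟩ := hc
      have hmK : K * p t₁ ≤ m t₁ :=
        cone_invariant_of_ineq hK1 hμpos hcK16 hp' hm' hposm hpd_le hmd_ge htc hcone0
      -- at the exit point: `m ≥ K p`, so `ℋ` is too large
      set ξ₁ := ξ t₁ with hξ₁
      have hAξ : ⟪A ξ₁, ξ₁⟫ ≤ α * p t₁ - μ * m t₁ :=
        inner_apply_self_le_of_eigen' hA b hb hαge ξ₁ (hneg_i ξ₁ (hξe t₁))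
      have hquad : (1 - 2 * γ) * (μ / 4) * ‖ξ₁‖ ^ 2 ≤ (2 * γ - 1) * ⟪A ξ₁, ξ₁⟫ := by
        have h1 : α * p t₁ ≤ K * μ / 2 * p t₁ := mul_le_mul_of_nonneg_right hKα (hpnn t₁)
        have h2 : μ / 2 * (K * p t₁) ≤ μ / 2 * m t₁ :=
          mul_le_mul_of_nonneg_left hmK (by positivity)
        have h3 : ⟪A ξ₁, ξ₁⟫ ≤ -(μ / 2) * m t₁ := by linarith only [hAξ, h1, h2]
        have hpK : p t₁ ≤ K * p t₁ := le_mul_of_one_le_left (hpnn t₁) hK1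
        have h4 : ‖ξ₁‖ ^ 2 ≤ 2 * m t₁ := by
          rw [← hpm t₁]; linarith only [hmK, hpK]
        have h5 := mul_le_mul_of_nonpos_left h3 (by linarith only [hγ2] : 2 * γ - 1 ≤ 0)
        have h6 := mul_le_mul_of_nonneg_left h4 (mul_nonneg h12.le (by positivity : (0:ℝ) ≤ μ / 4))
        linarith only [h5, h6]
      have hH := hexp (Γ t₁) (hΓN t₁ ⟨ht₁pos.le, le_rfl⟩)
        ((hΓz t₁ ⟨ht₁pos.le, le_rfl⟩).trans (by linarith)) ξ₁
        ((hξle t₁ ⟨ht₁pos.le, le_rfl⟩).trans (by linarith))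
      rw [← hHb, ← hV, hHΓ t₁ ⟨ht₁pos.le, le_rfl⟩, ← hYΓξ t₁] at hH
      rw [← hAdef] at hH
      have hξpos : 0 < ‖ξ₁‖ ^ 2 := pow_pos (norm_pos_iff.2 (hξne t₁ ⟨ht₁pos.le, le_rfl⟩)) 2
      have e1 : ν * ‖ξ₁‖ ^ 2 = (1 - 2 * γ) * μ / 16 * ‖ξ₁‖ ^ 2 := by rw [hν]
      have hgain : 0 < (1 - 2 * γ) * μ / 16 * ‖ξ₁‖ ^ 2 :=
        mul_pos (div_pos (mul_pos h12 hμpos) (by norm_num)) hξpos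
      have hH' : Hb z + (1 / 2 * ((2 * γ - 1) * ⟪A ξ₁, ξ₁⟫) - ν * ‖ξ₁‖ ^ 2) ≤ Hb (Y t₁) := hH
      linarith only [hH', hquad, e1, hgain, hHlt]
    · /- Case B: never in the cone — `p` decays, the trajectory cannot reach the exit sphere -/
      push Not at hc
      have hζ0 : ‖ζ 0‖ < ε := by simp only [hζdef, hY0, ← dist_eq_norm]; exact hxε
      have hτ0 : |τ 0| ≤ ε :=
        ((abs_real_inner_le_norm e (ζ 0)).trans (by rw [he1, one_mul])).trans hζ0.le
      have hp0 : p 0 ≤ 9 * ε ^ 2 := by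
        have h1 : p 0 ≤ ‖ξ 0‖ ^ 2 := by rw [← hpm 0]; linarith only [hmnn 0]
        have hg0' := hgτ' 0 ⟨le_rfl, ht₁pos.le⟩
        have h2 : ‖ξ 0‖ ≤ 3 * ε := by
          calc ‖ξ 0‖ ≤ ‖ζ 0 - τ 0 • e‖ + ‖g (τ 0)‖ := norm_sub_le _ _
            _ ≤ (‖ζ 0‖ + ‖τ 0 • e‖) + ‖g (τ 0)‖ := add_le_add (norm_sub_le _ _) le_rfl
            _ ≤ 3 * ε := by
                rw [norm_smul, Real.norm_eq_abs, he1, mul_one]; linarith only [hζ0, hτ0, hg0', hεpos]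
        have h3 := pow_le_pow_left₀ (norm_nonneg _) h2 2
        linarith only [h1, h3]
      have hρS : 4 * ρ * (3 * (1 + K) * ε) / μ = ε := by rw [hρ]; field_simp; ring
      obtain ⟨hτ1, hξ1⟩ := decay_regime_bounds hK1 hμpos hcst0 hcK2 hρpos hεpos hρS ht₁pos hp' hτ'
        hpm hpnn hc hpd_le hτdle hp0 hτ0
      -- the exit sphere is not reached
      have ht₁mem : t₁ ∈ Icc 0 t₁ := right_mem_Icc.2 ht₁pos.le
      have hζ1 : ‖ζ t₁‖ < r := by
        have e1 : ζ t₁ = τ t₁ • e + g (τ t₁) + ξ t₁ := by simp only [hξdef]; abel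
        have h2 := hgτ' t₁ ht₁mem
        rw [e1]
        calc ‖τ t₁ • e + g (τ t₁) + ξ t₁‖ ≤ ‖τ t₁ • e + g (τ t₁)‖ + ‖ξ t₁‖ := norm_add_le _ _
          _ ≤ (‖τ t₁ • e‖ + ‖g (τ t₁)‖) + ‖ξ t₁‖ := add_le_add (norm_add_le _ _) le_rfl
          _ ≤ (2 * ε + 2 * ε / 4) + 3 * (1 + K) * ε := by
              rw [norm_smul, Real.norm_eq_abs, he1, mul_one]
              exact add_le_add (add_le_add hτ1 (h2.trans (by linarith only [hτ1]))) hξ1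
          _ < r := by nlinarith only [hεK, hεpos, hK1]
      exact absurd hexit (ne_of_lt hζ1)
  /- ── an open set inside the trapped set: contradiction with the cone lemma ── -/
  have hOo : IsOpen {y : EuclideanSpace ℝ (Fin 3) | curl U y ≠ 0} := isOpen_vorticalSet h
  have hsub : ball z ε ∩ {y | curl U y ≠ 0} ⊆ {x : EuclideanSpace ℝ (Fin 3) |
      ∀ t, 0 ≤ t → lipschitzFlow hK x (-t) ∈ closedBall z δ₀} := by
    rintro x ⟨hxball, hxO⟩ t ht
    have := htrap x hxO (mem_ball.1 hxball) t ht
    exact closedBall_subset_closedBall (by linarith only [hrδ₀, hrpos]) this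
  have hne : (ball z ε ∩ {y | curl U y ≠ 0}).Nonempty :=
    (mem_closure_iff_nhds.1 hcl) _ (ball_mem_nhds z hεpos)
  obtain ⟨x, hx⟩ := hne
  have hxint : x ∈ interior {x : EuclideanSpace ℝ (Fin 3) |
      ∀ t, 0 ≤ t → lipschitzFlow hK x (-t) ∈ closedBall z δ₀} :=
    mem_interior.2 ⟨_, hsub, isOpen_ball.inter hOo, hx⟩
  rw [hthin] at hxint
  exact hxint

end Summit.NavierStokesRegularity.NavierStokesRegularity.Theorems.PowerGaugeEulerLiouville.NodalContinuum
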